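import Literature.NumberTheory.LFunctions.WeilTwoPrimeOddMarginEBase
import Literature.NumberTheory.LFunctions.WeilTwoPrimeOddMarginEDataDn2
import Literature.NumberTheory.LFunctions.WeilBlockRowsPZ
import HarnessLib

/-!
# Two-prime odd-margin certificate E: the Bessel block claim `Hp = C H Cᵀ`, rows 20–24

`WeilCert.checkHpRow` for rows 20–24 of certificate E (the exact Legendre cancellation `C H Cᵀ = diag(2a₀/(4i+3))`), by `decide +kernel`. Pure proof file.
-/

noncomputable section

namespace Literature.NumberTheory.LFunctions

set_option maxHeartbeats 0 in
/-- Row 20 of `C H Cᵀ` is row 20 of `Hp` (certificate E). [folklore] -/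
theorem checkHpRow1_20_weilCert23E : weilCert23EBase.checkHpRow weilCert23EHp 1 20 = true := by
  decide +kernel

set_option maxHeartbeats 0 in
/-- Row 21 of `C H Cᵀ` is row 21 of `Hp` (certificate E). [folklore] -/
theorem checkHpRow1_21_weilCert23E : weilCert23EBase.checkHpRow weilCert23EHp 1 21 = true := by
  decide +kernel

set_option maxHeartbeats 0 in
/-- Row 22 of `C H Cᵀ` is row 22 of `Hp` (certificate E). [folklore] -/
theorem checkHpRow1_22_weilCert23E : weilCert23EBase.checkHpRow weilCert23EHp 1 22 = true := by
  decide +kernel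

set_option maxHeartbeats 0 in
/-- Row 23 of `C H Cᵀ` is row 23 of `Hp` (certificate E). [folklore] -/
theorem checkHpRow1_23_weilCert23E : weilCert23EBase.checkHpRow weilCert23EHp 1 23 = true := by
  decide +kernel

set_option maxHeartbeats 0 in
/-- Row 24 of `C H Cᵀ` is row 24 of `Hp` (certificate E). [folklore] -/
theorem checkHpRow1_24_weilCert23E : weilCert23EBase.checkHpRow weilCert23EHp 1 24 = true := by
  decide +kernel


end Literature.NumberTheory.LFunctions
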